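import Mathlib
import Summits.Ventures.PercRepro.TriangleCapRowWitness

/-!
# PercRepro — THE ROUND-ROBIN STAIRCASE: EVERY COLLISION COUNT DOWN TO THE BALANCED MINIMUM, IN STEPS OF AT MOST
`2 t` (p3, gen 51; part 238)

The round-robin left ends `lfRR ℓ u i = 1` for `i < u` and `1 + (i mod ℓ)` for `u ≤ i` distribute `t` off-pairs over the
`ℓ` left vertices `1, …, ℓ`: at `u = t` all at the vertex `1` (collision count `t (t − 1)`), at `u = 0` the balanced
distribution (`q = ⌊t / ℓ⌋`, `ρ = t mod ℓ`: `ρ` classes of `q + 1` and `ℓ − ρ` classes of `q`, collision count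
`ℓ q (q − 1) + 2 ρ q`), and consecutive `u` differ by the move of ONE index, which changes the collision count by at
most `2 t` (`coll_le_coll_add_of_eq_off`).  The covering lemma (`cover_stair`) turns this into: every even
`2 j ≤ 2 t + t (t − 1) − coll (lfRR ℓ 0)` is `2 (t − m) + (t (t − 1) − coll (lfRR ℓ u))` for some `u, m ≤ t`
(`stair_attained`).  Axioms: standard.
-/

namespace PercRepro

namespace TriangleCap

namespace C047

open Finset

/-- The round-robin left ends: `1` for `i < u`, `1 + (i mod ℓ)` for `u ≤ i`. -/
def lfRR (ℓ u i : ℕ) : ℕ := if i < u then 1 else 1 + i % ℓ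

/-- `1 ≤ lfRR ℓ u i ≤ ℓ` for `1 ≤ ℓ`. -/
theorem lfRR_bounds (ℓ u i : ℕ) (hℓ : 1 ≤ ℓ) : 1 ≤ lfRR ℓ u i ∧ lfRR ℓ u i ≤ ℓ := by
  unfold lfRR
  have := Nat.mod_lt i (by omega : 0 < ℓ)
  split_ifs <;> omega

/-- The class count of a left end. -/
def cls (t : ℕ) (lf : ℕ → ℕ) (x : ℕ) : ℕ := ((range t).filter (fun i => lf i = x)).card

/-- **THE COLLISION COUNT AS A SUM OVER CLASSES:** `coll t lf = Σ_{x ∈ T} cls x (cls x − 1)` when `lf` maps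
`range t` into `T`. -/
theorem coll_eq_sum_cls (t : ℕ) (lf : ℕ → ℕ) (T : Finset ℕ) (hT : ∀ i, i < t → lf i ∈ T) :
    coll t lf = ∑ x ∈ T, cls t lf x * (cls t lf x - 1) := by
  unfold coll
  rw [card_eq_sum_card_fiberwise (f := fun p : ℕ × ℕ => lf p.1) (t := T) (by
    intro p hp
    simp only [coe_filter, mem_offDiag, mem_range, Set.mem_setOf_eq] at hp
    exact hT p.1 hp.1.1)]
  apply sum_congr rfl
  intro x _
  have : ((range t).offDiag.filter (fun p : ℕ × ℕ => lf p.1 = lf p.2)).filter (fun p => lf p.1 = x) =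
      ((range t).filter (fun i => lf i = x)).offDiag := by
    ext p
    simp only [mem_filter, mem_offDiag, mem_range]
    constructor
    · rintro ⟨⟨⟨h1, h2, h3⟩, h4⟩, h5⟩
      exact ⟨⟨h1, h5⟩, ⟨h2, by rw [← h4]; exact h5⟩, h3⟩
    · rintro ⟨⟨h1, h5⟩, ⟨h2, h6⟩, h3⟩
      exact ⟨⟨⟨h1, h2, h3⟩, by rw [h5, h6]⟩, h5⟩
  rw [this, offDiag_card]
  unfold cls
  rw [Nat.mul_sub_one]

/-- The collision count is even. -/
theorem coll_even (t : ℕ) (lf : ℕ → ℕ) : Even (coll t lf) := by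
  rw [coll_eq_sum_cls t lf ((range t).image lf) (fun i hi => mem_image_of_mem lf (mem_range.mpr hi))]
  apply even_sum
  intro x _
  exact Nat.even_mul_pred_self _

/-- **THE SINGLE MOVE:** two left-end functions agreeing off one index `i₀ < t` have collision counts within `2 t`. -/
theorem coll_le_coll_add_of_eq_off (t : ℕ) (lf lf' : ℕ → ℕ) (i₀ : ℕ) (h : ∀ i, i < t → i ≠ i₀ → lf i = lf' i) :
    coll t lf ≤ coll t lf' + 2 * t := by
  unfold coll
  have hsub : (range t).offDiag.filter (fun p : ℕ × ℕ => lf p.1 = lf p.2) ⊆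
      (range t).offDiag.filter (fun p : ℕ × ℕ => lf' p.1 = lf' p.2) ∪
        (({i₀} ×ˢ range t) ∪ (range t ×ˢ {i₀})) := by
    intro p hp
    rw [mem_filter, mem_offDiag, mem_range, mem_range] at hp
    obtain ⟨⟨h1, h2, h3⟩, h4⟩ := hp
    rw [mem_union, mem_filter, mem_offDiag, mem_range, mem_range, mem_union, mem_product, mem_product,
      mem_singleton, mem_singleton, mem_range, mem_range]
    by_cases hp1 : p.1 = i₀
    · right; left; exact ⟨hp1, h2⟩
    · by_cases hp2 : p.2 = i₀
      · right; right; exact ⟨h1, hp2⟩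
      · left
        exact ⟨⟨h1, h2, h3⟩, by rw [← h p.1 h1 hp1, ← h p.2 h2 hp2]; exact h4⟩
  have h1 := card_le_card hsub
  have h2 := card_union_le ((range t).offDiag.filter (fun p : ℕ × ℕ => lf' p.1 = lf' p.2))
    (({i₀} ×ˢ range t) ∪ (range t ×ˢ {i₀}))
  have h3 := card_union_le ({i₀} ×ˢ range t) (range t ×ˢ {i₀})
  rw [card_product, card_product, card_singleton, card_range] at h3
  omega

/-- `lfRR ℓ (u + 1)` and `lfRR ℓ u` agree off the index `u`. -/
theorem lfRR_eq_off (ℓ u i : ℕ) (hi : i ≠ u) : lfRR ℓ (u + 1) i = lfRR ℓ u i := by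
  unfold lfRR
  by_cases h : i < u
  · rw [if_pos (by omega), if_pos h]
  · rw [if_neg (by omega), if_neg h]

/-- At `u = t` every off-pair sits at the vertex `1`: `coll = t (t − 1)`. -/
theorem coll_lfRR_top (ℓ t : ℕ) : coll t (lfRR ℓ t) = t * (t - 1) := by
  rw [coll_eq_sum_cls t (lfRR ℓ t) {1} (fun i hi => by
    simp only [mem_singleton]
    unfold lfRR
    rw [if_pos hi])]
  rw [sum_singleton]
  unfold cls
  have : (range t).filter (fun i => lfRR ℓ t i = 1) = range t := by
    apply filter_true_of_mem
    intro i hi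
    rw [mem_range] at hi
    unfold lfRR
    rw [if_pos hi]
  rw [this, card_range]

/-- **THE RESIDUE-CLASS COUNT:** `#{i < t : i mod ℓ = y} = ⌊t / ℓ⌋ + [y < t mod ℓ]` for `y < ℓ`. -/
theorem card_filter_mod_eq (ℓ : ℕ) (hℓ : 0 < ℓ) (y : ℕ) (hy : y < ℓ) (t : ℕ) :
    ((range t).filter (fun i => i % ℓ = y)).card = t / ℓ + if y < t % ℓ then 1 else 0 := by
  induction t with
  | zero => simp
  | succ t ih =>
    rw [Finset.range_add_one, filter_insert]
    have hmod := Nat.mod_lt t hℓ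
    have hdiv := Nat.div_add_mod t ℓ
    by_cases hcase : t % ℓ + 1 < ℓ
    · obtain ⟨h1, h2⟩ : (t + 1) / ℓ = t / ℓ ∧ (t + 1) % ℓ = t % ℓ + 1 :=
        (Nat.div_mod_unique hℓ).mpr ⟨by omega, hcase⟩
      rw [h1, h2]
      by_cases hy' : t % ℓ = y
      · rw [if_pos hy', card_insert_of_notMem (by simp), ih]
        split_ifs <;> omega
      · rw [if_neg hy', ih]
        split_ifs <;> omega
    · have hmul : ℓ * (t / ℓ + 1) = ℓ * (t / ℓ) + ℓ := Nat.mul_succ ℓ (t / ℓ)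
      obtain ⟨h1, h2⟩ : (t + 1) / ℓ = t / ℓ + 1 ∧ (t + 1) % ℓ = 0 :=
        (Nat.div_mod_unique hℓ).mpr ⟨by omega, hℓ⟩
      rw [h1, h2]
      by_cases hy' : t % ℓ = y
      · rw [if_pos hy', card_insert_of_notMem (by simp), ih]
        split_ifs <;> omega
      · rw [if_neg hy', ih]
        split_ifs <;> omega

/-- The class of the vertex `y + 1` under the balanced round-robin is the residue class `y`. -/
theorem cls_lfRR_zero (ℓ t y : ℕ) (hℓ : 0 < ℓ) (hy : y < ℓ) :
    cls t (lfRR ℓ 0) (y + 1) = t / ℓ + if y < t % ℓ then 1 else 0 := by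
  unfold cls
  rw [← card_filter_mod_eq ℓ hℓ y hy t]
  apply congrArg
  apply filter_congr
  intro i _
  unfold lfRR
  rw [if_neg (by omega)]
  omega

/-- **THE BALANCED COLLISION COUNT:** `coll t (lfRR ℓ 0) = ℓ q (q − 1) + 2 ρ q` with `q = ⌊t / ℓ⌋`, `ρ = t mod ℓ`. -/
theorem coll_lfRR_zero (ℓ t : ℕ) (hℓ : 0 < ℓ) :
    coll t (lfRR ℓ 0) = ℓ * ((t / ℓ) * (t / ℓ - 1)) + 2 * ((t % ℓ) * (t / ℓ)) := by
  rw [coll_eq_sum_cls t (lfRR ℓ 0) ((range ℓ).image (· + 1)) (fun i hi => by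
    rw [mem_image]
    refine ⟨i % ℓ, mem_range.mpr (Nat.mod_lt i hℓ), ?_⟩
    unfold lfRR
    rw [if_neg (by omega)]
    omega)]
  rw [sum_image (fun y _ y' _ h => by omega)]
  have hterm : ∀ y ∈ range ℓ, cls t (lfRR ℓ 0) (y + 1) * (cls t (lfRR ℓ 0) (y + 1) - 1) =
      if y < t % ℓ then (t / ℓ + 1) * (t / ℓ) else (t / ℓ) * (t / ℓ - 1) := by
    intro y hy
    rw [mem_range] at hy
    rw [cls_lfRR_zero ℓ t y hℓ hy]
    split_ifs <;> simp
  rw [sum_congr rfl hterm, sum_ite, sum_const, sum_const, smul_eq_mul, smul_eq_mul]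
  have hmod := Nat.mod_lt t hℓ
  have e1 : (range ℓ).filter (fun y => y < t % ℓ) = range (t % ℓ) := by
    ext y
    simp only [mem_filter, mem_range]
    omega
  have e2 : (range ℓ).filter (fun y => ¬ y < t % ℓ) = Ico (t % ℓ) ℓ := by
    ext y
    simp only [mem_filter, mem_range, mem_Ico]
    omega
  rw [e1, e2, card_range, Nat.card_Ico]
  obtain ⟨q, hq⟩ : ∃ q, t / ℓ = q := ⟨_, rfl⟩
  obtain ⟨ρ, hρ⟩ : ∃ ρ, t % ℓ = ρ := ⟨_, rfl⟩
  rw [hq, hρ]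
  rw [hρ] at hmod
  obtain ⟨ℓ', rfl⟩ : ∃ ℓ', ℓ = ρ + ℓ' := ⟨ℓ - ρ, by omega⟩
  rw [Nat.add_sub_cancel_left]
  rcases Nat.eq_zero_or_pos q with rfl | hq0
  · simp
  · obtain ⟨q', rfl⟩ : ∃ q', q = q' + 1 := ⟨q - 1, by omega⟩
    rw [Nat.add_sub_cancel]
    ring

/-- **THE COVERING LEMMA:** a sequence `E` on `[0, t]` with `E t = 0` and `E u ≤ E (u + 1) + 2 t` covers, with the fill
`2 (t − m)`, every even number up to `E u' + 2 t`: for `u ≤ t`, every `j` with `2 j ≤ E u' + 2 t` for some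
`u ≤ u' ≤ t` is `2 j = 2 (t − m) + E u'` for some `u ≤ u' ≤ t` and `m ≤ t`. -/
theorem cover_stair (t : ℕ) (E : ℕ → ℕ) (hE0 : E t = 0) (hEeven : ∀ u, Even (E u))
    (hstep : ∀ u, u < t → E u ≤ E (u + 1) + 2 * t) :
    ∀ k, k ≤ t → ∀ j, (∃ u', t - k ≤ u' ∧ u' ≤ t ∧ 2 * j ≤ E u' + 2 * t) →
      ∃ u', t - k ≤ u' ∧ u' ≤ t ∧ ∃ m, m ≤ t ∧ 2 * j = 2 * (t - m) + E u' := by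
  intro k
  induction k with
  | zero =>
    intro _ j ⟨u', hu1, hu2, hj⟩
    have : u' = t := by omega
    rw [this, hE0] at hj
    exact ⟨t, by omega, le_rfl, t - j, by omega, by rw [hE0]; omega⟩
  | succ k ih =>
    intro hk j ⟨u', hu1, hu2, hj⟩
    by_cases hu : t - k ≤ u'
    · obtain ⟨u'', h1, h2, m, hm, hjm⟩ := ih (by omega) j ⟨u', hu, hu2, hj⟩
      exact ⟨u'', by omega, h2, m, hm, hjm⟩
    · have hu' : u' = t - (k + 1) := by omega
      subst hu'
      by_cases hj' : 2 * j ≤ E (t - (k + 1) + 1) + 2 * t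
      · obtain ⟨u'', h1, h2, m, hm, hjm⟩ := ih (by omega) j ⟨t - (k + 1) + 1, by omega, by omega, hj'⟩
        exact ⟨u'', by omega, h2, m, hm, hjm⟩
      · have hs := hstep (t - (k + 1)) (by omega)
        obtain ⟨e, he⟩ := hEeven (t - (k + 1))
        refine ⟨t - (k + 1), le_rfl, by omega, t - (j - e), by omega, ?_⟩
        omega

/-- **THE STAIRCASE ATTAINS EVERY VALUE DOWN TO THE BALANCED MINIMUM:** every `j` with
`2 j ≤ 2 t + t (t − 1) − coll t (lfRR ℓ 0)` is `2 (t − m) + (t (t − 1) − coll t (lfRR ℓ u))` for some `u, m ≤ t`. -/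
theorem stair_attained (ℓ t j : ℕ) (hj : 2 * j + coll t (lfRR ℓ 0) ≤ 2 * t + t * (t - 1)) :
    ∃ u, u ≤ t ∧ ∃ m, m ≤ t ∧ 2 * j = 2 * (t - m) + (t * (t - 1) - coll t (lfRR ℓ u)) := by
  have hle : ∀ u, coll t (lfRR ℓ u) ≤ t * (t - 1) := fun u => coll_le t _
  have h := cover_stair t (fun u => t * (t - 1) - coll t (lfRR ℓ u))
    (by show t * (t - 1) - coll t (lfRR ℓ t) = 0; rw [coll_lfRR_top, Nat.sub_self])
    (fun u => by
      obtain ⟨c, hc⟩ := coll_even t (lfRR ℓ u)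
      obtain ⟨d, hd⟩ := Nat.even_mul_pred_self t
      have := hle u
      exact ⟨d - c, by omega⟩)
    (fun u _ => by
      have h1 := coll_le_coll_add_of_eq_off t (lfRR ℓ (u + 1)) (lfRR ℓ u) u (fun i _ hi => lfRR_eq_off ℓ u i hi)
      have := hle u
      have := hle (u + 1)
      show t * (t - 1) - coll t (lfRR ℓ u) ≤ t * (t - 1) - coll t (lfRR ℓ (u + 1)) + 2 * t
      omega)
    t le_rfl j ⟨0, by omega, by omega, by have := hle 0; omega⟩
  obtain ⟨u, -, hu, m, hm, hjm⟩ := h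
  exact ⟨u, hu, m, hm, hjm⟩

end C047

end TriangleCap

end PercRepro
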